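import Literature.NumberTheory.QuadraticFields.KroneckerSplitting
import Literature.NumberTheory.EllipticCurves.HeegnerPointsOfConductor
import HarnessLib

/-!
# Class X10b (and any Heegner frame with `d_K ≡ 1 (mod 8)`): KOLYVAGIN CONDUCTORS ARE ODD — the
# `ℓ ≠ 2` guard of Gross's Prop. 3.7 (2) / McCallum's Prop. 4.4 at `p = 3`, discharged by the frame

Print-tier cell `bsd-print-x9` (D-0131 (2), key `x9`), typer seat ty2, file M of the discharge
interface. Theorems only: no definition, no new named fact
(D-0014 / D-0026); nothing here is a class theorem; X10b keeps its label.

WHY (cell dossier v6 §19.4 caveat, lit g6 TURNKEY 17:27:26Z, DOSSIER v7 §22.3 / 22.9). McCallum's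
Prop. 4.4 = Jetchev's Prop. 4.7 is KERNEL at irreducible image modulo the image-free named fact (γ)
`GrossLMS1991.prop37_2_frobeniusCongruence` (Gross Prop. 3.7 (2) = Nekovář 2007 Prop. 4.13 (ii)) — but
only on its branch «`ℓ ≠ 2`»: p4's port `JET.Split.…Prop47` (`Theorems/PrintX9JetchevSplitProp47.lean`)
carries `(hl2 : l ≠ 2)` explicitly. A Zhang–Kolyvagin prime `ℓ` of index `≥ 1` has `p ∣ ℓ + 1`, so
`ℓ = 2` forces `p = 3`: impossible on X9 (`p ≥ 5`), POSSIBLE on X10b (crux J₃ = `HeegnerDivisibilityX10b`,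
item stmt-BirchSwinnertonDyer-21205) exactly when `2 ∤ N_E`, `2` is INERT in `K` (`d_K ≡ 5 mod 8`) and
`a_2(E) = 0` (live on 2 of the 39 rank-1 X10b census pairs: 233167c1, 492635l1). The X10b Heegner road
(`Theorems/PrintX10bHeegnerRoad.lean`) takes its field from the typed Hoffstein–Luo fact with
`d_K ≡ 1 (mod 8)` (`hd8K`, l.159), i.e. `2` SPLIT in `K`; on such a frame `(2) ⊂ 𝓞_K` is NOT prime, so
`2` is never a Kolyvagin prime (Zhang's or Gross's: both require `(ℓ)` inert) and every Kolyvagin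
conductor is odd. This file proves exactly that, so the `hl2` guard is discharged BY NAME from the
frame binder `NumberField.discr K % 8 = 1` (the ONE-BINDER restate of 21205 recommended by lit, or
p4's `hd8K` inside the road).

WHAT.
1. `primesOver_subset_singleton_of_isPrime_span`, `ncard_primesOver_le_one_of_isPrime_span` — an
   inert rational prime `ℓ` (`(ℓ) ⊂ 𝓞_K` prime) has exactly the one prime `(ℓ)` above it (a non-zero
   prime of a Dedekind domain is maximal).
2. `not_isPrime_span_two_of_discr_mod_eight_eq_one` — for `K` quadratic with `d_K ≡ 1 (mod 8)`,
   `(2)` is not prime in `𝓞_K` (decomposition law at `2`: `Quadratic.ncard_primesOver_two_eq_two_iff`,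
   two primes above `2`).
3. `ne_two_of_zhangKolyvaginPrime_of_discr_mod_eight_eq_one` (Zhang 2014 (xii)),
   `ne_two_of_isKolyvaginPrime_of_discr_mod_eight_eq_one` (Gross 1991 (3.1)),
   `forall_primeFactors_ne_two_of_discr_mod_eight_eq_one`, `not_two_dvd_of_discr_mod_eight_eq_one` —
   on such a frame every Kolyvagin prime is `≠ 2` and every square-free Kolyvagin conductor is odd.
   (The statements do not read `E` beyond the conductor-free predicate, so the frame forms ARE the
   leaf forms: no `ClassX10` binder is needed; `…_of_heegner_…` takes `IsImaginaryQuadratic K`.)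

## References

* [GrossLMS1991] B. H. Gross, LMS LN 153 (1991), §3 (3.1) («ℓ remains inert in K»), Prop. 3.7 (2).
* [WZhang2014] W. Zhang, Camb. J. Math. 2 (2014), Notations (xii) («ℓ … inert in K»).
* [McCallumLMS1991] W. G. McCallum, LMS LN 153 (1991), §4 p. 300 (S_r(M): «l inert»), Prop. 4.4.
* [Marcus1977] D. A. Marcus, *Number Fields*, Ch. 3, Thm. 25 (decomposition of `2` in a quadratic
  field: split iff `d ≡ 1 mod 8`). [folklore]
presearch (D-0021): `lean search 'KolyvaginPrime.*two|ne_two_of_isKolyvaginPrime'` → only the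
Kato-prime version `Derivative.Rat.ne_two_of_isKolyvaginPrime` (Kim's `ℓ ≡ 1 mod p^k`, a different
notion); nothing for Heegner/Zhang Kolyvagin primes — this file. Corpus: the decomposition law is
folklore (Marcus Thm. 25), already a tree theorem.
-/

set_option autoImplicit false

noncomputable section

open scoped Classical

open NumberField Ideal Literature.NumberTheory.EllipticCurves
  Literature.NumberTheory.QuadraticFields

namespace Literature.NumberTheory.EllipticCurves.Rank1Residual

/-! ### 1. An inert rational prime has one prime above it -/

section Inert

variable {K : Type*} [Field K] [NumberField K]

/-- **The primes of `𝓞_K` above an INERT rational prime `ℓ` are just `(ℓ)`**: if `(ℓ) ⊂ 𝓞_K` is prime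
(and `ℓ ≠ 0`), every prime `Q` over `ℓℤ` contains `ℓ`, hence `(ℓ) ≤ Q`, hence `Q = (ℓ)` since a
non-zero prime of the Dedekind domain `𝓞_K` is maximal. [folklore] -/
theorem primesOver_subset_singleton_of_isPrime_span {ℓ : ℕ}
    (hℓ : (Ideal.span {(ℓ : 𝓞 K)}).IsPrime) (hℓ0 : ℓ ≠ 0) :
    (Ideal.span {(ℓ : ℤ)}).primesOver (𝓞 K) ⊆ {Ideal.span {(ℓ : 𝓞 K)}} := by
  intro Q hQ
  obtain ⟨hQp, hQo⟩ := hQ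
  rw [Set.mem_singleton_iff]
  -- `ℓ ∈ Q`: `Q` lies over `ℓℤ`
  have hmem : (ℓ : 𝓞 K) ∈ Q := by
    have h : (ℓ : ℤ) ∈ Q.under ℤ := by
      rw [← hQo.over]
      exact Ideal.mem_span_singleton_self _
    rw [Ideal.under_def, Ideal.mem_comap, map_natCast] at h
    exact h
  have hle : Ideal.span {(ℓ : 𝓞 K)} ≤ Q := by
    rw [Ideal.span_le, Set.singleton_subset_iff]
    exact hmem
  have hne : Ideal.span {(ℓ : 𝓞 K)} ≠ ⊥ := by
    rw [Ne, Ideal.span_singleton_eq_bot]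
    exact_mod_cast hℓ0
  exact ((hℓ.isMaximal hne).eq_of_le hQp.ne_top hle).symm

/-- **At most one prime above an inert rational prime.** [folklore] -/
theorem ncard_primesOver_le_one_of_isPrime_span {ℓ : ℕ}
    (hℓ : (Ideal.span {(ℓ : 𝓞 K)}).IsPrime) (hℓ0 : ℓ ≠ 0) :
    ((Ideal.span {(ℓ : ℤ)}).primesOver (𝓞 K)).ncard ≤ 1 := by
  calc ((Ideal.span {(ℓ : ℤ)}).primesOver (𝓞 K)).ncard
      ≤ ({Ideal.span {(ℓ : 𝓞 K)}} : Set (Ideal (𝓞 K))).ncard :=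
        Set.ncard_le_ncard (primesOver_subset_singleton_of_isPrime_span hℓ hℓ0) (Set.finite_singleton _)
    _ = 1 := Set.ncard_singleton _

/-! ### 2. `d_K ≡ 1 (mod 8)`: `2` splits, so `(2)` is not prime -/

/-- **For a quadratic field `K` with `d_K ≡ 1 (mod 8)`, the ideal `(2) ⊂ 𝓞_K` is NOT prime**: by the
decomposition law at `2` (`Quadratic.ncard_primesOver_two_eq_two_iff`, Marcus Thm. 25) there are two
primes above `2`, whereas an inert `2` would have one (§1). [folklore] -/
theorem not_isPrime_span_two_of_discr_mod_eight_eq_one (hK2 : Module.finrank ℚ K = 2)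
    (hd : NumberField.discr K % 8 = 1) : ¬ (Ideal.span {(2 : 𝓞 K)}).IsPrime := by
  intro h2
  have htwo : ((Ideal.span {(2 : ℤ)}).primesOver (𝓞 K)).ncard = 2 :=
    (Quadratic.ncard_primesOver_two_eq_two_iff hK2).mpr hd
  have hle : ((Ideal.span {((2 : ℕ) : ℤ)}).primesOver (𝓞 K)).ncard ≤ 1 :=
    ncard_primesOver_le_one_of_isPrime_span (K := K) (ℓ := 2) (by exact_mod_cast h2) two_ne_zero
  rw [Nat.cast_ofNat] at hle
  omega

end Inert

/-! ### 3. Kolyvagin primes and conductors on a frame with `d_K ≡ 1 (mod 8)` -/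

section Kolyvagin

variable {K : Type} [Field K] [NumberField K] (N : ℕ) (W : WeierstrassCurve ℚ) [W.IsGloballyMinimal]
  (p : ℕ)

/-- **A Zhang–Kolyvagin prime is `≠ 2` when `d_K ≡ 1 (mod 8)`** (Zhang 2014 (xii): «ℓ … inert in
K», recorded as `(Ideal.span {ℓ}).IsPrime`; `2` split is not inert, §2). The `hl2` guard of p4's
`JET.Split` Prop. 4.7 port / of (γ) `GrossLMS1991.prop37_2_frobeniusCongruence`, from the frame.
[cite: WZhang2014, Notations (xii)] [cite: GrossLMS1991, §3 (3.1), Prop. 3.7 (2)] -/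
theorem ne_two_of_zhangKolyvaginPrime_of_discr_mod_eight_eq_one (hK2 : Module.finrank ℚ K = 2)
    (hd : NumberField.discr K % 8 = 1) {ℓ : ℕ} (hℓ : Zhang2014.IsKolyvaginPrime N W K p ℓ) : ℓ ≠ 2 := by
  rintro rfl
  exact not_isPrime_span_two_of_discr_mod_eight_eq_one hK2 hd (by exact_mod_cast hℓ.2.2.2.2.1)

omit [W.IsGloballyMinimal] in
/-- **A Gross–Kolyvagin prime (`Frob ℓ = Frob ∞` form, Gross 1991 (3.1)) is `≠ 2` when
`d_K ≡ 1 (mod 8)`.** [cite: GrossLMS1991, §3 (3.1)] -/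
theorem ne_two_of_isKolyvaginPrime_of_discr_mod_eight_eq_one (hK2 : Module.finrank ℚ K = 2)
    (hd : NumberField.discr K % 8 = 1) {ℓ : ℕ} (hℓ : IsKolyvaginPrime N W K p ℓ) : ℓ ≠ 2 := by
  rintro rfl
  exact not_isPrime_span_two_of_discr_mod_eight_eq_one hK2 hd (by exact_mod_cast hℓ.2.2.2.2.1)

/-- **Every prime factor of a Kolyvagin conductor is `≠ 2` when `d_K ≡ 1 (mod 8)`** — the
per-conductor form of the guard, in the currency `∀ ℓ ∈ c.primeFactors, Zhang2014.IsKolyvaginPrime …`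
of J / J₃ (`HeegnerDivisibilityX9`, `HeegnerDivisibilityX10b`) and of the H63 line.
[cite: WZhang2014, Notations (xii)] -/
theorem forall_primeFactors_ne_two_of_discr_mod_eight_eq_one (hK2 : Module.finrank ℚ K = 2)
    (hd : NumberField.discr K % 8 = 1) {c : ℕ}
    (hcK : ∀ ℓ ∈ c.primeFactors, Zhang2014.IsKolyvaginPrime N W K p ℓ) :
    ∀ ℓ ∈ c.primeFactors, ℓ ≠ 2 := fun ℓ hℓ ↦
  ne_two_of_zhangKolyvaginPrime_of_discr_mod_eight_eq_one N W p hK2 hd (hcK ℓ hℓ)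

/-- **Kolyvagin conductors are ODD when `d_K ≡ 1 (mod 8)`**: a natural number `c ≠ 0` all of whose
prime factors are Zhang–Kolyvagin primes is not divisible by `2`. [cite: WZhang2014, Notations (xii)] -/
theorem not_two_dvd_of_discr_mod_eight_eq_one (hK2 : Module.finrank ℚ K = 2)
    (hd : NumberField.discr K % 8 = 1) {c : ℕ} (hc : c ≠ 0)
    (hcK : ∀ ℓ ∈ c.primeFactors, Zhang2014.IsKolyvaginPrime N W K p ℓ) : ¬ 2 ∣ c := fun h2 ↦
  forall_primeFactors_ne_two_of_discr_mod_eight_eq_one N W p hK2 hd hcK 2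
    (Nat.mem_primeFactors.mpr ⟨Nat.prime_two, h2, hc⟩) rfl

/-- **Imaginary-quadratic spelling** (the frame binder of J₃ / of the X10b Heegner road is
`IsImaginaryQuadratic K`, whose first component is `finrank ℚ K = 2`): a Zhang–Kolyvagin prime on a
Heegner frame with `d_K ≡ 1 (mod 8)` is odd. [cite: WZhang2014, Notations (xii)] -/
theorem ne_two_of_zhangKolyvaginPrime_of_heegner_of_discr_mod_eight_eq_one (hK : IsImaginaryQuadratic K)
    (hd : NumberField.discr K % 8 = 1) {ℓ : ℕ} (hℓ : Zhang2014.IsKolyvaginPrime N W K p ℓ) : ℓ ≠ 2 :=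
  ne_two_of_zhangKolyvaginPrime_of_discr_mod_eight_eq_one N W p hK.1 hd hℓ

end Kolyvagin

end Literature.NumberTheory.EllipticCurves.Rank1Residual

end
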